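import Summits.HodgeConjecture.HodgeConjecture.Theorems.EndoscopicMiddleDegreeOrthogonalSplit
import Summits.HodgeConjecture.HodgeConjecture.Theorems.HeckePrymWeilWeilTwelvefoldsSqrtMinus7HodgeModelFacts
import Literature.AlgebraicGeometry.HodgeTheory.GysinProjectionNonvanishing
import Literature.AlgebraicGeometry.HodgeTheory.CrossProductTopClass
import Literature.AlgebraicGeometry.HodgeTheory.ComplexGysinCorrespondence
import Literature.AlgebraicGeometry.HodgeTheory.CorrespondenceCupProductIdentities
import Literature.AlgebraicGeometry.HodgeTheory.MotivatedClassesAlgebraic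
import Literature.AlgebraicGeometry.HodgeTheory.GysinFormalismCorrespondences
import Literature.AlgebraicGeometry.Motives.VarietiesProjectiveSpaceProofs
import HarnessLib

/-!
# Crux `IsotypicMiddleClassesAlgebraic` (stmt-HodgeConjecture-14301), line `IdeatorTwoSketch` (Line B):
# the line's residue is CIRCULAR — the crux implies the (pointwise, P-projected) SWEEP stub

Line B of the crux chain (idea `hodge-index-left-inverse`) reduces the crux
`EndoscopicMiddleDegree.IsotypicMiddleClassesAlgebraic` to an ENGINE (landed: `stub_inversion`,
`stub_transposeAlgebraic`, `stub_corrActionAlgebraic`, `stub_kernel`, `stub_topGysinInjective`) plus ONE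
existence stub, in its weakest useful form `stub_sweepProjected`: a smooth projective surface `F` and an
algebraic class `Φ` of codimension `m + 2` on `F ⊗ X` such that every rational `P`-fixed class `c` is
cup-orthogonal to every rational Hodge `(n,n)`-class `k` which is orthogonal to all the `P`-projected
cylinder classes `P(ᵗΦ y)`, `ᵗΦ y = pr_{X*}(pr_F^* y ∪ Φ)`, `y` a rational `(1,1)`-class on `F`.

THIS FILE PROVES that the crux IMPLIES the pointwise form of that stub (the family may depend on the
fixed class `c`; the pointwise form still closes the crux through the same engine, since the
composition uses the family only after `c` is fixed):
`stub_sweepCircular`. Hence, granted the engine and the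
classical facts it consumes, the residue of Line B is EQUIVALENT to the crux: the line has no reduction
power beyond its engine (lead's verdict `line-dead`, `Cruxes/IsotypicMiddleClassesAlgebraic/Lines/
IdeatorTwoSketch.dead.md`). The crux itself is untouched (it follows from the Hodge conjecture,
`Negative/NoKillShortOfHC`).

PROOF — the CYLINDER REMARK: every algebraic middle class is a cylinder class of a CONSTANT family.
Given the crux, a rational `P`-fixed `c` is algebraic. Take `F = ℙ²` (`projectiveSpace 2 ℂ`, smooth
projective: `isSmoothProjective_projectiveSpace_holds`), `y₀ = [H]` the hyperplane class of the Kähler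
package of `F` (rational, in `N¹H²`, hence of type `(1,1)` by Grothendieck's coniveau inclusion), and
`Φ := pr_F^* y₀ ∪ pr_X^* c` — algebraic of codimension `1 + n = m + 2` (flat pull-backs preserve the
support filtration, `map_fst_mem_supportedClasses` / `map_snd_mem_supportedClasses`, and the route's
support item `CupProductAlgebraic`). Then, by associativity and naturality of `∪`, graded commutativity
in even degrees and the projection formula (`complexGysin_cup`),
`ᵗΦ(y₀) = pr_{X*}(pr_F^*(y₀ ∪ y₀) ∪ pr_X^* c) = c ∪ pr_{X*} pr_F^*(y₀ ∪ y₀) = ε • c`, where the fibre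
integral `pr_{X*} pr_F^*(y₀ ∪ y₀) = ε • 1 ∈ H⁰(X(ℂ))` (`exists_eq_smul_one`) is NON-ZERO
(`complexGysin_snd_map_fst_ne_zero`) because `y₀ ∪ y₀ ≠ 0` (hard Lefschetz on the surface:
`L² : H⁰ → H⁴` is injective and `1 ≠ 0`). So `k ⊥ P(ᵗΦ y₀) = ε • P c = ε • c` forces `k ∪ c = 0`,
i.e. `c ∪ k = 0`.

Hypotheses: `CupProductAlgebraic` (route support item stmt-HodgeConjecture-14350, exactly as the engine
takes it), `Grothendieck1969_supportedClasses_le_hodgeConiveau` and the Kähler package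
`hardLefschetz_hodgeRiemann` (two of the four classical named facts of the line's `stub_classicalFacts`),
and the crux. No sorry, no new definition.
-/

noncomputable section

-- `Summit.HodgeConjecture.HodgeConjecture.Theorems` is the mandated namespace (single-problem summit:
-- Problem = Summit), flagged by `linter.dupNamespace`; the lakefile turns the linter off tree-wide (weak
-- option), restated here so stand-alone elaboration is warning-free too.
set_option linter.dupNamespace false

open CategoryTheory MonoidalCategory CartesianMonoidalCategory
open Literature.AlgebraicGeometry Literature.AlgebraicGeometry.Motives
open Literature.AlgebraicGeometry.HodgeTheory Literature.AlgebraicGeometry.ShimuraVarieties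
open Literature.AlgebraicTopology.SingularHomology Literature.Geometry.Kaehler
open scoped Manifold

namespace Summit.HodgeConjecture.HodgeConjecture.Theorems

/-- Degree bookkeeping for the transpose (cylinder) map `ᵗΦ : H²(F) → H^{2n}(X)` (same statement and
name as the line's private lemma in the engine files; proofs of a `Prop` are irrelevant). -/
private theorem lineB_deg_transpose (m : ℕ) :
    2 * (1 + (m + 2)) + 2 * (2 * (m + 1)) = 2 * (m + 1) + 2 * (2 + 2 * (m + 1)) := by ring

/-- Index transport inside `algebraicClasses`: the membership `a ∪ b ∈ Nʳ H^{2r}` does not depend on how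
the codimension `r` and the degree proof are written. [folklore] -/
theorem cupProduct_mem_algebraicClasses_of_eq {Y : SchemeOver ℂ} {p q r s : ℕ} (hrs : r = s)
    (h₁ : p + q = 2 * r) (h₂ : p + q = 2 * s) (a : complexBetti Y p) (b : complexBetti Y q)
    (h : cupProduct h₁ a b ∈ algebraicClasses Y r) : cupProduct h₂ a b ∈ algebraicClasses Y s := by
  subst hrs
  exact h

/-- **`[H] ∪ [H] ≠ 0` on a smooth projective surface** carrying a hard Lefschetz datum `Λ`: the
Lefschetz iterate `L² : H⁰(F(ℂ)) → H⁴(F(ℂ))` is injective (hard Lefschetz, `k = 0`, `j = 2`) and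
`1 ≠ 0` in `H⁰(F(ℂ))` (a non-zero top class `w = w ∪ 1` exists), while `L² 1 = [H] ∪ ([H] ∪ 1)`.
[cite: VoisinHodgeI2002, Thm. 6.25] -/
theorem hyperplaneClass_cup_self_ne_zero (μ : OrientationFamily) {F : SchemeOver ℂ}
    (hF : IsSmoothProjective 2 F) (Λ : HardLefschetzNFold 2 F) :
    cupProduct (show 2 * 1 + 2 * 1 = 2 * 2 by rfl) (Λ.hyperplaneClass : complexBetti F (2 * 1))
      Λ.hyperplaneClass ≠ 0 := by
  obtain ⟨w, hw, -⟩ := exists_isRationalClass_top_ne_zero μ hF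
  have h1 : singularCohomology.one ℂ (ComplexPoints F) ≠ 0 := by
    intro h0
    apply hw
    rw [← cupProduct_one w, h0, map_zero]
  have hinj := (Λ.hasHardLefschetz 2 0 rfl).1
  intro hzero
  apply h1
  apply hinj
  rw [map_zero, lefschetzPow_succ, lefschetzPow_succ, lefschetzPow_zero, LinearMap.comp_apply,
    LinearMap.comp_apply, LinearMap.id_apply, lefschetzOperator_apply, lefschetzOperator_apply]
  have hone : cupProduct (show 2 + (0 + 2 * 0) = 0 + 2 * 1 by rfl) Λ.hyperplaneClass
      (singularCohomology.one ℂ (ComplexPoints F)) = Λ.hyperplaneClass := cupProduct_one _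
  rw [hone]
  exact hzero

/-- **The crux implies the pointwise P-projected SWEEP stub of Line B** — registered stub
`stub_sweepCircular` of the line's skeleton `Lines/IdeatorTwoSketch.lean` (cylinder remark; module
docstring). For the data of `EndoscopicMiddleDegree.IsotypicMiddleClassesAlgebraic` and a rational
`P`-fixed class `c` there is a smooth projective surface `F` (namely `ℙ²`) and an ALGEBRAIC class `Φ` of
codimension `m + 2` on `F ⊗ X` (namely `pr_F^*[H] ∪ pr_X^* c`) such that every rational Hodge
`(n,n)`-class `k` cup-orthogonal to all `P`-projected cylinder classes `P(ᵗΦ y)` (`y` rational `(1,1)` on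
`F`) is cup-orthogonal to `c` — because `ᵗΦ([H]) = ε • c` with `ε ≠ 0`. Consequently the existence stub
`stub_sweepProjected` of the line (and a fortiori `stub_sweep`) is, granted the landed engine, no weaker
than the crux it was meant to reduce. Conditional on the route support item `CupProductAlgebraic`
(stmt-HodgeConjecture-14350) and the named facts `Grothendieck1969_supportedClasses_le_hodgeConiveau`,
`hardLefschetz_hodgeRiemann` — the same inputs the engine consumes.
[cite: VoisinHodgeII2003, proof of Prop. 9.21 (i)] [cite: FultonYoungTableaux1997, Appendix B §B.1 (6)] -/
theorem stub_sweepCircular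
    (h9 : Theses.EndoscopicMiddleDegree.CupProductAlgebraic)
    (hG : Grothendieck1969_supportedClasses_le_hodgeConiveau)
    (hK : ∀ (d : ℕ) (Y : SchemeOver ℂ), hardLefschetz_hodgeRiemann d Y)
    (hcrux : Theses.EndoscopicMiddleDegree.IsotypicMiddleClassesAlgebraic)
    (μ : OrientationFamily) (hμ : μ.HasPoincareDuality) (m : ℕ) (X : SchemeOver ℂ)
    (D : UnitaryBallQuotientDatum (2 * (m + 1)) X) (h1 : 1 ≤ m) (h2 : m ≤ 2)
    (γ : complexBetti (X ⊗ X) (2 * (2 * (m + 1))))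
    (hγ : γ ∈ algebraicClasses (X ⊗ X) (2 * (m + 1)))
    (hPrat : ∀ β, IsRationalClass β → IsRationalClass (corrAction μ D.isSmoothProjective
      D.isSmoothProjective
      (rfl : 2 * (m + 1) + 2 * (2 * (m + 1)) = 2 * (m + 1) + 2 * (2 * (m + 1))) γ β))
    (hPhdg : ∀ β, IsOfHodgeType (2 * (m + 1)) X (2 * (m + 1)) (m + 1) (m + 1)
      (corrAction μ D.isSmoothProjective D.isSmoothProjective
        (rfl : 2 * (m + 1) + 2 * (2 * (m + 1)) = 2 * (m + 1) + 2 * (2 * (m + 1))) γ β))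
    (c : complexBetti X (2 * (m + 1))) (hc : IsRationalClass c)
    (hPc : corrAction μ D.isSmoothProjective D.isSmoothProjective
      (rfl : 2 * (m + 1) + 2 * (2 * (m + 1)) = 2 * (m + 1) + 2 * (2 * (m + 1))) γ c = c) :
    ∃ (F : SchemeOver ℂ) (hF : IsSmoothProjective 2 F) (Φ : complexBetti (F ⊗ X) (2 * (m + 2)))
      (_ : Φ ∈ algebraicClasses (F ⊗ X) (m + 2)),
      ∀ k : complexBetti X (2 * (m + 1)), IsRationalClass k →
        IsOfHodgeType (2 * (m + 1)) X (2 * (m + 1)) (m + 1) (m + 1) k →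
        (∀ y : complexBetti F (2 * 1), IsRationalClass y → IsOfHodgeType 2 F (2 * 1) 1 1 y →
          cupProduct (two_mul_add_two_mul (m + 1) (m + 1)) k
            (corrAction μ D.isSmoothProjective D.isSmoothProjective
              (rfl : 2 * (m + 1) + 2 * (2 * (m + 1)) = 2 * (m + 1) + 2 * (2 * (m + 1))) γ
              (complexGysin μ (IsSmoothProjective.tensor_holds hF D.isSmoothProjective)
                D.isSmoothProjective (snd F X) (lineB_deg_transpose m)
                (cupProduct (two_mul_add_two_mul 1 (m + 2))
                  (complexBetti.map (fst F X) (2 * 1) y) Φ))) = 0) →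
        cupProduct (two_mul_add_two_mul (m + 1) (m + 1)) c k = 0 := by
  have hX : IsSmoothProjective (2 * (m + 1)) X := D.isSmoothProjective
  -- `c` is algebraic, by the crux
  have hcalg : c ∈ algebraicClasses X (m + 1) := hcrux μ hμ m X D h1 h2 γ hγ hPrat hPhdg c hc hPc
  -- the surface `F = ℙ²` and its hyperplane class
  have hF : IsSmoothProjective 2 (projectiveSpace 2 ℂ) := isSmoothProjective_projectiveSpace_holds ℂ 2
  obtain ⟨Λ, -⟩ := hK 2 (projectiveSpace 2 ℂ) hF
  obtain ⟨A⟩ := (WeilTwelvefoldsSqrtMinus7.AmnesicSecantSheaves.nonempty_hodgeModel_all_holds 2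
    (projectiveSpace 2 ℂ)).nonempty hF
  have hy₀A : Λ.hyperplaneClass ∈ algebraicClasses (projectiveSpace 2 ℂ) 1 := Λ.hyperplaneClass_mem
  have hy₀Q : IsRationalClass Λ.hyperplaneClass := Λ.isRationalClass_hyperplaneClass
  have hy₀T : IsOfHodgeType 2 (projectiveSpace 2 ℂ) (2 * 1) 1 1 Λ.hyperplaneClass :=
    ⟨A, pullback_mem_hodgePQ_of_mem_supportedClasses hG hF A hy₀A⟩
  have hFX : IsSmoothProjective (2 + 2 * (m + 1)) (projectiveSpace 2 ℂ ⊗ X) :=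
    IsSmoothProjective.tensor_holds hF hX
  -- the constant family `Φ = pr_F^* [H] ∪ pr_X^* c`
  have hΦdeg : 2 * 1 + 2 * (m + 1) = 2 * (m + 2) := by ring
  refine ⟨projectiveSpace 2 ℂ, hF,
    cupProduct hΦdeg (complexBetti.map (fst (projectiveSpace 2 ℂ) X) (2 * 1) Λ.hyperplaneClass)
      (complexBetti.map (snd (projectiveSpace 2 ℂ) X) (2 * (m + 1)) c), ?_, ?_⟩
  · exact cupProduct_mem_algebraicClasses_of_eq (by ring) (two_mul_add_two_mul 1 (m + 1)) hΦdeg _ _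
      (h9 hFX 1 (m + 1) _ _ (map_fst_mem_supportedClasses hF hX hy₀A)
        (map_snd_mem_supportedClasses hF hX hcalg))
  intro k hkQ hkT hk
  have hk₀ := hk Λ.hyperplaneClass hy₀Q hy₀T
  -- the cylinder class over `[H]`: `ᵗΦ([H]) = c ∪ pr_{X*} pr_F^*([H] ∪ [H])`
  have h11 : 2 * 1 + 2 * 1 = 2 * 2 := rfl
  have hm : 2 * 2 + 2 * (m + 1) = 2 * (1 + (m + 2)) := by ring
  have hm' : 2 * (m + 1) + 2 * 2 = 2 * (1 + (m + 2)) := by ring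
  have hq : 2 * 2 + 2 * (2 * (m + 1)) = 0 + 2 * (2 + 2 * (m + 1)) := by ring
  set g := complexGysin μ hFX hX (snd (projectiveSpace 2 ℂ) X) hq
      (complexBetti.map (fst (projectiveSpace 2 ℂ) X) (2 * 2)
        (cupProduct h11 (Λ.hyperplaneClass : complexBetti (projectiveSpace 2 ℂ) (2 * 1))
          Λ.hyperplaneClass)) with hgdef
  have hcyl : complexGysin μ (IsSmoothProjective.tensor_holds hF D.isSmoothProjective)
      D.isSmoothProjective (snd (projectiveSpace 2 ℂ) X) (lineB_deg_transpose m)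
      (cupProduct (two_mul_add_two_mul 1 (m + 2))
        (complexBetti.map (fst (projectiveSpace 2 ℂ) X) (2 * 1) Λ.hyperplaneClass)
        (cupProduct hΦdeg (complexBetti.map (fst (projectiveSpace 2 ℂ) X) (2 * 1) Λ.hyperplaneClass)
          (complexBetti.map (snd (projectiveSpace 2 ℂ) X) (2 * (m + 1)) c))) =
      cupProduct (Nat.add_zero (2 * (m + 1))) c g := by
    rw [← cupProduct_assoc h11 hΦdeg hm (two_mul_add_two_mul 1 (m + 2)),
      ← complexBetti.map_cupProduct,
      cupProduct_gradedComm_holds ℂ _ hm hm',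
      Even.neg_one_pow (⟨2 * (2 * (m + 1)), by ring⟩ : Even (2 * 2 * (2 * (m + 1)))), one_smul]
    exact complexGysin_cup hμ hFX hX (snd (projectiveSpace 2 ℂ) X) hm' (lineB_deg_transpose m)
      hq (Nat.add_zero _) c _
  -- the fibre integral `g = pr_{X*} pr_F^*([H] ∪ [H])` is `ε • 1` with `ε ≠ 0`
  have hg : g ≠ 0 :=
    complexGysin_snd_map_fst_ne_zero μ hF hX (hyperplaneClass_cup_self_ne_zero μ hF Λ)
  obtain ⟨ε, hε⟩ := exists_eq_smul_one μ hX g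
  have hε0 : ε ≠ 0 := by
    rintro rfl
    exact hg (by rw [hε, zero_smul])
  -- `ᵗΦ([H]) = ε • c`, `P(ε • c) = ε • c`, so `ε • (k ∪ c) = 0`
  rw [hcyl, hε, map_smul, cupProduct_one, map_smul, hPc, map_smul, smul_eq_zero] at hk₀
  have hkc : cupProduct (two_mul_add_two_mul (m + 1) (m + 1)) k c = 0 := hk₀.resolve_left hε0
  rw [cupProduct_gradedComm_holds ℂ _ (two_mul_add_two_mul (m + 1) (m + 1))
    (two_mul_add_two_mul (m + 1) (m + 1)) c k, hkc, smul_zero]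

end Summit.HodgeConjecture.HodgeConjecture.Theorems

end
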